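import Summits.NavierStokesRegularity.NavierStokesRegularity.Theorems.TerminalTraceTypeITraceScarL3StubLocalTypeIOfTypeIBlowup
import Summits.NavierStokesRegularity.NavierStokesRegularity.Theorems.TerminalTraceTypeITraceScarL3StubExtinctApexDOfL3Trace
import Summits.NavierStokesRegularity.NavierStokesRegularity.Theorems.TerminalTraceTypeITraceScarL3StubNoConfinedExtinctApex
import HarnessLib

/-!
# HEREDITY for item `TerminalTrace.TypeITraceScarL3` (stmt-NavierStokesRegularity-18385): under an `L³`
# terminal trace, every singular point of the trace ball blows up to a SPREAD extinct Type-I apex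

Seat ns-typeII-p3 g9 (cell ns-regularity-ideate), `--supports stmt-NavierStokesRegularity-18385` (helper;
nsreg-p2 ROUND-25 §1b HEREDITY / seed s25-5: "under the item's hypotheses at `(T, x₀)`, every
`x₁ ∈ Σ_T ∩ B(x₀, ρ)` yields a spread extinct apex — pure logic over the registered signatures; the
induction shape for any attack on Stub C through the geometry of `Σ_T`").

* `exists_spreadExtinctApex_of_L3trace` — let `u` be a classical Leray–Hopf solution on `[0, T)`,
  Type-I in time, with `u(T) ∈ L³(B(x₀, ρ))`.  Then EVERY point `x₁ ∈ B(x₀, ρ)` at which `(T, x₁)` is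
  backward singular (unbounded in every `Q_r(T, x₁)`) carries a SPREAD extinct Type-I apex: a tuple
  `(U, P, G, M, D₀, C)` with the six registered clauses of line `apex-dichotomy` (suitable in every
  `Q(a)`, weak gradient, `𝐈(Q(a)) ≤ M`, `D(z₀, r) ≤ D₀`, rate `C/√(−s)`, weakly null top), backward
  singular at the origin, and NOT essentially bounded in any exterior backward slab.  Proof: the trace
  ball `B(x₁, ρ − dist x₁ x₀) ⊆ B(x₀, ρ)` feeds Stub 2′ (`stub_extinctApexD_of_L3trace`, p583907, over
  Stub 1 `stub_localTypeI_of_typeIBlowup`, p576636) at the vertex `(T, x₁)`; the resulting apex is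
  singular, so by Stub B (`stub_no_confinedExtinctApex`, p585263) it is not confined, i.e. it is spread.
* `traceBall_regular_of_no_spreadExtinctApex` — the contrapositive packaging at every vertex of the ball:
  if no spread extinct apex exists, an `L³` trace ball contains NO backward-singular vertex at all
  (not only its centre): `Σ_T ∩ B(x₀, ρ) = ∅`.

WHAT THIS IS NOT: not Stub C, not NS regularity — by-name compositions of the landed Stubs 1, 2′, B.
[folklore; Seregin2014 §6.6; AlbrittonBarker2019 §3; EscauriazaSereginSverak2003 Thm 5.1]
-/

noncomputable section

set_option linter.dupNamespace false

namespace Summit.NavierStokesRegularity.NavierStokesRegularity.Theorems.TypeITraceScarL3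

open MeasureTheory Set Function Filter Topology Metric
open Literature.Analysis.FluidPDE
open scoped NNReal ENNReal InnerProductSpace RealInnerProductSpace

/-- **Heredity: every singular point of an `L³` trace ball blows up to a SPREAD extinct Type-I apex.**
For a classical Leray–Hopf solution on `[0, T)`, Type-I in time, with `u(T) ∈ L³(B(x₀, ρ))`, and any
`x₁ ∈ B(x₀, ρ)` with `(T, x₁)` backward singular, there is an extinct Type-I apex `(U, P, G, M, D₀, C)`
(the six registered clauses of line `apex-dichotomy`), backward singular at the origin and spread (not
essentially bounded in any exterior backward slab `]−δ, 0[ × (closedBall 0 R)ᶜ`).  Composition of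
Stub 2′ at the vertex `(T, x₁)` (trace ball `B(x₁, ρ − dist x₁ x₀)`) with Stub B.
[folklore; Seregin2014 §6.6; AlbrittonBarker2019 §3] -/
theorem exists_spreadExtinctApex_of_L3trace
    {ν T : ℝ} (hν : 0 < ν) (hT : 0 < T)
    {u : ℝ → EuclideanSpace ℝ (Fin 3) → EuclideanSpace ℝ (Fin 3)}
    {p : ℝ → EuclideanSpace ℝ (Fin 3) → ℝ}
    (hcl : IsClassicalNSSolutionOn (Ico 0 T) ν 0 u p) (hLH : IsLerayHopfOn T ν 0 (u 0) u)
    (hTI : IsTypeIBlowup u T) {x₀ : EuclideanSpace ℝ (Fin 3)} {ρ : ℝ}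
    (hmem : MemLp (u T) 3 (volume.restrict (ball x₀ ρ)))
    {x₁ : EuclideanSpace ℝ (Fin 3)} (hx₁ : x₁ ∈ ball x₀ ρ)
    (hsing : ∀ r : ℝ, 0 < r →
      eLpNorm (uncurry u) ⊤ (volume.restrict (parabolicCylinder r (T, x₁))) = ⊤) :
    ∃ (U : ℝ → EuclideanSpace ℝ (Fin 3) → EuclideanSpace ℝ (Fin 3))
      (P : ℝ → EuclideanSpace ℝ (Fin 3) → ℝ)
      (G : ℝ → EuclideanSpace ℝ (Fin 3) →
        EuclideanSpace ℝ (Fin 3) →L[ℝ] EuclideanSpace ℝ (Fin 3))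
      (M D₀ : ℝ≥0) (C : ℝ),
      (∀ a : ℝ, 0 < a →
        IsSuitableWeakSolutionInBall a (0 : ℝ × EuclideanSpace ℝ (Fin 3)) U P) ∧
      (∀ a : ℝ, 0 < a →
        HasWeakSpatialGradientOn
          (parabolicCylinderOpens a (0 : ℝ × EuclideanSpace ℝ (Fin 3))) U G) ∧
      (∀ a : ℝ, 0 < a →
        typeIBound (parabolicCylinder a (0 : ℝ × EuclideanSpace ℝ (Fin 3))) U P G ≤ M) ∧
      (∀ z₀ : ℝ × EuclideanSpace ℝ (Fin 3), z₀.1 ≤ 0 →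
        ∀ r : ℝ, 0 < r → cknD r z₀ P ≤ D₀) ∧
      (∀ s : ℝ, s < 0 →
        ∀ᵐ y : EuclideanSpace ℝ (Fin 3), ‖U s y‖ ≤ C / Real.sqrt (-s)) ∧
      (∀ φ : EuclideanSpace ℝ (Fin 3) → EuclideanSpace ℝ (Fin 3),
        ContDiff ℝ (⊤ : ℕ∞) φ →
        HasCompactSupport φ → ∀ ε : ℝ, 0 < ε →
        ∃ s₀ : ℝ, s₀ < 0 ∧ ∀ᵐ s ∂(volume.restrict (Ioo s₀ 0)), |∫ y, ⟪U s y, φ y⟫| ≤ ε) ∧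
      IsBackwardSingularPoint U (0 : ℝ × EuclideanSpace ℝ (Fin 3)) ∧
      (∀ δ : ℝ, 0 < δ → ∀ R K : ℝ,
        ¬ (∀ᵐ z ∂(volume.restrict
          (Ioo (-δ) 0 ×ˢ (closedBall (0 : EuclideanSpace ℝ (Fin 3)) R)ᶜ)), ‖U z.1 z.2‖ ≤ K)) := by
  -- the trace ball at `x₁`
  set ρ₁ : ℝ := ρ - dist x₁ x₀ with hρ₁def
  have hρ₁ : 0 < ρ₁ := by rw [hρ₁def]; linarith [mem_ball.1 hx₁]
  have hsub : ball x₁ ρ₁ ⊆ ball x₀ ρ := by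
    intro y hy
    rw [mem_ball] at hy ⊢
    have := dist_triangle y x₁ x₀
    linarith
  have hmem₁ : MemLp (u T) 3 (volume.restrict (ball x₁ ρ₁)) :=
    hmem.mono_measure (Measure.restrict_mono hsub le_rfl)
  -- Stub 2′ at the vertex `(T, x₁)` over Stub 1
  obtain ⟨U, P, G, M, D₀, C, hsw, hG, hI, hD, hrate, htop, hsingU⟩ :=
    stub_extinctApexD_of_L3trace ν T hν hT u p hcl hLH hTI x₁
      (TerminalTraceTypeITraceScarL3StubLocalTypeIOfTypeIBlowup.stub_localTypeI_of_typeIBlowup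
        ν T hν hT u p hcl hLH hTI x₁)
      hsing ⟨ρ₁, hρ₁, hmem₁⟩
  refine ⟨U, P, G, M, D₀, C, hsw, hG, hI, hD, hrate, htop, hsingU, ?_⟩
  -- spread, by Stub B
  intro δ hδ R K hbound
  exact stub_no_confinedExtinctApex U P G M D₀ C hsw hG hI hD hrate htop ⟨δ, hδ, R, K, hbound⟩ hsingU

/-- **No spread extinct apex ⇒ an `L³` trace ball is entirely regular** (heredity, contrapositive form at
every vertex of the ball): if no spread extinct Type-I apex is backward singular (the statement of Stub C
`stub_no_spreadExtinctApex`), then under the item's hypotheses with `u(T) ∈ L³(B(x₀, ρ))` NO point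
`x₁ ∈ B(x₀, ρ)` is a backward-singular vertex — `Σ_T ∩ B(x₀, ρ) = ∅`, not only `x₀ ∉ Σ_T`.
[folklore; Seregin2014 §6.6] -/
theorem traceBall_regular_of_no_spreadExtinctApex
    (hC : ∀ (U : ℝ → EuclideanSpace ℝ (Fin 3) → EuclideanSpace ℝ (Fin 3))
      (P : ℝ → EuclideanSpace ℝ (Fin 3) → ℝ)
      (G : ℝ → EuclideanSpace ℝ (Fin 3) →
        EuclideanSpace ℝ (Fin 3) →L[ℝ] EuclideanSpace ℝ (Fin 3))
      (M D₀ : ℝ≥0) (C : ℝ),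
      (∀ a : ℝ, 0 < a →
        IsSuitableWeakSolutionInBall a (0 : ℝ × EuclideanSpace ℝ (Fin 3)) U P) →
      (∀ a : ℝ, 0 < a →
        HasWeakSpatialGradientOn
          (parabolicCylinderOpens a (0 : ℝ × EuclideanSpace ℝ (Fin 3))) U G) →
      (∀ a : ℝ, 0 < a →
        typeIBound (parabolicCylinder a (0 : ℝ × EuclideanSpace ℝ (Fin 3))) U P G ≤ M) →
      (∀ z₀ : ℝ × EuclideanSpace ℝ (Fin 3), z₀.1 ≤ 0 →
        ∀ r : ℝ, 0 < r → cknD r z₀ P ≤ D₀) →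
      (∀ s : ℝ, s < 0 →
        ∀ᵐ y : EuclideanSpace ℝ (Fin 3), ‖U s y‖ ≤ C / Real.sqrt (-s)) →
      (∀ φ : EuclideanSpace ℝ (Fin 3) → EuclideanSpace ℝ (Fin 3),
        ContDiff ℝ (⊤ : ℕ∞) φ →
        HasCompactSupport φ → ∀ ε : ℝ, 0 < ε →
        ∃ s₀ : ℝ, s₀ < 0 ∧ ∀ᵐ s ∂(volume.restrict (Ioo s₀ 0)), |∫ y, ⟪U s y, φ y⟫| ≤ ε) →
      (∀ δ : ℝ, 0 < δ → ∀ R K : ℝ,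
        ¬ (∀ᵐ z ∂(volume.restrict
          (Ioo (-δ) 0 ×ˢ (closedBall (0 : EuclideanSpace ℝ (Fin 3)) R)ᶜ)), ‖U z.1 z.2‖ ≤ K)) →
      ¬ IsBackwardSingularPoint U (0 : ℝ × EuclideanSpace ℝ (Fin 3)))
    {ν T : ℝ} (hν : 0 < ν) (hT : 0 < T)
    {u : ℝ → EuclideanSpace ℝ (Fin 3) → EuclideanSpace ℝ (Fin 3)}
    {p : ℝ → EuclideanSpace ℝ (Fin 3) → ℝ}
    (hcl : IsClassicalNSSolutionOn (Ico 0 T) ν 0 u p) (hLH : IsLerayHopfOn T ν 0 (u 0) u)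
    (hTI : IsTypeIBlowup u T) {x₀ : EuclideanSpace ℝ (Fin 3)} {ρ : ℝ}
    (hmem : MemLp (u T) 3 (volume.restrict (ball x₀ ρ)))
    {x₁ : EuclideanSpace ℝ (Fin 3)} (hx₁ : x₁ ∈ ball x₀ ρ) :
    ∃ r : ℝ, 0 < r ∧
      eLpNorm (uncurry u) ⊤ (volume.restrict (parabolicCylinder r (T, x₁))) ≠ ⊤ := by
  by_contra hnot
  push Not at hnot
  obtain ⟨U, P, G, M, D₀, C, hsw, hG, hI, hD, hrate, htop, hsingU, hspread⟩ :=
    exists_spreadExtinctApex_of_L3trace hν hT hcl hLH hTI hmem hx₁ hnot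
  exact hC U P G M D₀ C hsw hG hI hD hrate htop hspread hsingU

end Summit.NavierStokesRegularity.NavierStokesRegularity.Theorems.TypeITraceScarL3

end
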